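import Mathlib
import Summits.NavierStokesRegularity.NavierStokesRegularity.Theorems.EulerZoomLiouvillePowerGaugeEulerLiouvilleDSSEndpointShell
import HarnessLib

/-!
# Rung C2 of the crux `EulerZoomLiouville.PowerGaugeEulerLiouville` at the endpoint `ρ = 1/2`:
# the shell inequality of DSS members for ALMOST EVERY SLICE of a period (weak class)

Route №10 `EulerZoomLiouville` (NavierStokesRegularity), crux E = stmt-NavierStokesRegularity-19832,
stub `stub_nonSelfSimilarRest` (DSS endpoint stratum `IsDSSPowerSpread`).  The tree's
`dss_half_periodShell_le` (`…DSSEndpointShell`) bounds the PERIOD-INTEGRATED shell energy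
`∫_{I₀} ∫_{2L/l ≤ |y| ≤ L} |u|²` of a DSS member (`I₀ = (l^{5/2}τ₀, τ₀)` one period) by `K/L` times the
period fluxes at the scales `L` and `L/l`.  Here the SAME bound is proved for the shell energy of ALMOST
EVERY SLICE `τ ∈ I₀` (an `L^∞`-in-time statement, with the same right-hand side):

* `EndpointSobolev.dss_half_aeSliceShell_le` — for a suitable weak Euler pair, DSS with factor `l ≥ 2` at
  `ρ = 1/2`, and `τ₀ < 0`: `∃ K ≥ 0, ∀ L > 0, for a.e. τ ∈ I₀,
  ∫_{2L/l ≤ |y| ≤ L} |u(τ)|² ≤ (K/L) (∫_{I₀}∫_{L≤|y|≤2L} F + l ∫_{I₀}∫_{L/l≤|y|≤2L/l} F)`, `F = |u|³ + 2|p||u|`.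

Proof (adapted from the tree's `dss_half_periodShell_le`, steps (1)–(5), (9) verbatim): the forward
two-time local energy inequality gives, for a.e. good start `τ₁' ∈ I₀` and then a.e. `τ₂ ∈ I₀`,
`E_{σ_{2L}}(τ₂) ≤ E_{σ_{2L/l}}(τ₁') + Φ` (DSS moves the start slice `l^{5/2}τ₁'` to `τ₁'` one scale down).
Instead of averaging both times (tree), take the INFIMUM `m₀` of `E_{σ_{2L/l}}` over the (co-null) set of
good starts: a.e. slice has `E_{σ_{2L}}(τ₂) ≤ m₀ + Φ` and, being itself a good start, `m₀ ≤ E_{σ_{2L/l}}(τ₂)`;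
so the shell energy `E_{σ_{2L}}(τ₂) − E_{σ_{2L/l}}(τ₂) ≤ Φ` slice by slice.  This is what upgrades the
growth-free DSS endpoint drain from the rate `L^{−5/6}` (period-integrated energies) to `L^{−5/2}` (sup-in-time energies).

WHAT THIS IS NOT: not NS, not E, not the stub — one inequality. [cite: ChaeTsai2014, §3 Lemma 3.1; CaffarelliKohnNirenberg1982, §2 (2.5)]
-/

noncomputable section

-- flat `Theorems/<Route><Decl>…` files of one crux share the namespace of the crux (tree convention)
set_option linter.dupNamespace false

open MeasureTheory Set Filter Topology Metric Function TopologicalSpace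
open scoped ENNReal NNReal InnerProductSpace RealInnerProductSpace Laplacian

namespace Summit.NavierStokesRegularity.NavierStokesRegularity.Theorems.PowerGaugeEulerLiouville

open Literature.Analysis Literature.Analysis.FunctionSpaces Literature.Analysis.FluidPDE

namespace EndpointSobolev

section SliceShell

variable {u : ℝ → EuclideanSpace ℝ (Fin 3) → EuclideanSpace ℝ (Fin 3)}
  {p : ℝ → EuclideanSpace ℝ (Fin 3) → ℝ}

/-- **The shell inequality of a DSS endpoint member for a.e. slice of a period (weak class).**  For a
suitable weak Euler pair on `(−∞,0) × ℝ³`, DSS with factor `l ≥ 2` at `ρ = 1/2`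
(`u(τ,y) = l^{3/2}u(l^{5/2}τ, ly)`, `p(τ,y) = l³p(l^{5/2}τ, ly)`), and `τ₀ < 0`: there is `K ≥ 0` with,
for every `L > 0` and a.e. `τ ∈ I₀ = (l^{5/2}τ₀, τ₀)`,
`∫_{2L/l ≤ |y| ≤ L} |u(τ)|² ≤ (K/L)(∫_{I₀}∫_{L≤|y|≤2L} F + l ∫_{I₀}∫_{L/l≤|y|≤2L/l} F)`, `F = |u|³+2|p||u|`
— the slice-wise (sup-in-time) form of the tree's `dss_half_periodShell_le`.
[cite: ChaeTsai2014, §3 Lemma 3.1; CaffarelliKohnNirenberg1982, §2 (2.5)] -/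
-- adapted from the tree's `dss_half_periodShell_le` (…DSSEndpointShell): steps (6)–(8), (10) new
theorem dss_half_aeSliceShell_le
    (hsw : IsSuitableWeakSolutionOn (slab (EuclideanSpace ℝ (Fin 3)) (Iio 0) isOpen_Iio) 0 0 u p)
    {l : ℝ} (hl : 2 ≤ l)
    (hu : ∀ τ : ℝ, τ < 0 → ∀ y, u τ y = (l ^ (3 / 2 : ℝ)) • u (l ^ (5 / 2 : ℝ) * τ) (l • y))
    (hp : ∀ τ : ℝ, τ < 0 → ∀ y, p τ y = l ^ 3 * p (l ^ (5 / 2 : ℝ) * τ) (l • y))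
    {τ₀ : ℝ} (hτ₀ : τ₀ < 0) :
    ∃ K : ℝ, 0 ≤ K ∧ ∀ L : ℝ, 0 < L → ∀ᵐ τ' : ℝ, τ' ∈ Ioo (l ^ (5 / 2 : ℝ) * τ₀) τ₀ →
      ∫ y in {y : EuclideanSpace ℝ (Fin 3) | 2 * L / l ≤ ‖y‖ ∧ ‖y‖ ≤ L}, ‖u τ' y‖ ^ 2 ≤
        K / L * ((∫ τ in Ioo (l ^ (5 / 2 : ℝ) * τ₀) τ₀,
            ∫ y in {y : EuclideanSpace ℝ (Fin 3) | L ≤ ‖y‖ ∧ ‖y‖ ≤ 2 * L},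
              (‖u τ y‖ ^ 3 + 2 * (|p τ y| * ‖u τ y‖))) +
          l * ∫ τ in Ioo (l ^ (5 / 2 : ℝ) * τ₀) τ₀,
            ∫ y in {y : EuclideanSpace ℝ (Fin 3) | L / l ≤ ‖y‖ ∧ ‖y‖ ≤ 2 * L / l},
              (‖u τ y‖ ^ 3 + 2 * (|p τ y| * ‖u τ y‖))) := by
  -- constants of the member
  have hl0 : 0 < l := by linarith
  have hl1 : 1 < l := by linarith
  set b : ℝ := l ^ (5 / 2 : ℝ) with hb
  have hb1 : 1 < b := Real.one_lt_rpow hl1 (by norm_num)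
  have hb0 : 0 < b := by linarith
  set a : ℝ := l ^ (3 / 2 : ℝ) with ha
  have ha2 : a ^ 2 = l ^ 3 := by rw [ha, ← Real.rpow_natCast, ← Real.rpow_mul hl0.le]; norm_num
  have hbl : b * l ^ (-(3 / 2 : ℝ)) = l := by rw [hb, ← Real.rpow_add hl0]; norm_num
  -- the period and its length
  set T : ℝ := τ₀ - b * τ₀ with hT
  have hbτ : b * τ₀ < τ₀ := by nlinarith
  have hT0 : 0 < T := by rw [hT]; linarith
  have hbb : b * (b * τ₀) < b * τ₀ := mul_lt_mul_of_pos_left hbτ hb0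
  -- `|u|³ ∈ L¹_loc`
  have hu3 := locallyIntegrableOn_cube_of_suitable hsw
  -- the cut-offs at scales `L` and `L/l`
  obtain ⟨S, Kσ, hKσ0, hSrel, hS⟩ := exists_cutoffFamily
  refine ⟨Kσ / 2, by positivity, fun L hL => ?_⟩
  have hLl : 0 < 2 * L / l := by positivity
  have hLl' : 2 * L / l ≤ L := by rw [div_le_iff₀ hl0]; nlinarith
  obtain ⟨hσL_smooth, hσL_cpt, hσL_cont, hσL_nonneg, hσL_le, hσL_one', hσL_zero, hgradL_norm,
    hgradL_supp'⟩ := hS (2 * L) (by positivity)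
  obtain ⟨-, -, hσLl_cont, hσLl_nonneg, hσLl_le, -, hσLl_zero, -, -⟩ := hS (2 * L / l) hLl
  set σL : EuclideanSpace ℝ (Fin 3) → ℝ := S (2 * L) with hσL
  set σLl : EuclideanSpace ℝ (Fin 3) → ℝ := S (2 * L / l) with hσLl
  have hσL_one : ∀ y : EuclideanSpace ℝ (Fin 3), ‖y‖ ≤ L → σL y = 1 :=
    fun y hy => hσL_one' y (by linarith)
  have hgradL_supp : ∀ y, gradient σL y ≠ 0 → L ≤ ‖y‖ ∧ ‖y‖ ≤ 2 * L := fun y hy => by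
    have := hgradL_supp' y hy; exact ⟨by linarith [this.1], this.2⟩
  have hσLl_eq : ∀ z : EuclideanSpace ℝ (Fin 3), σL (l • z) = σLl z :=
    fun z => hSrel (2 * L) l z hl0.ne'
  -- `σLl ≤ σL` and `σL − σLl = 1` on the shell `2L/l ≤ |y| ≤ L`
  have hσdiff_nonneg : ∀ y : EuclideanSpace ℝ (Fin 3), 0 ≤ σL y - σLl y := fun y => by
    by_cases hy : ‖y‖ ≤ L
    · rw [hσL_one y hy]; linarith [hσLl_le y]
    · rw [not_le] at hy
      rw [hσLl_zero y (by linarith)]; linarith [hσL_nonneg y]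
  -- sets
  set I₀ : Set ℝ := Ioo (b * τ₀) τ₀ with hI₀
  set I₁ : Set ℝ := Ioo (b * (b * τ₀)) (b * τ₀) with hI₁
  set J : Set ℝ := Ioo (b * (b * τ₀)) τ₀ with hJ
  set SL : Set (EuclideanSpace ℝ (Fin 3)) := {y | L ≤ ‖y‖ ∧ ‖y‖ ≤ 2 * L} with hSL
  set SLl : Set (EuclideanSpace ℝ (Fin 3)) := {y | L / l ≤ ‖y‖ ∧ ‖y‖ ≤ 2 * L / l} with hSLl
  set AL : Set (EuclideanSpace ℝ (Fin 3)) := {y | 2 * L / l ≤ ‖y‖ ∧ ‖y‖ ≤ L} with hAL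
  have hSLm : MeasurableSet SL := (measurableSet_le measurable_const measurable_norm).inter
    (measurableSet_le measurable_norm measurable_const)
  have hSLlm : MeasurableSet SLl := (measurableSet_le measurable_const measurable_norm).inter
    (measurableSet_le measurable_norm measurable_const)
  have hALm : MeasurableSet AL := (measurableSet_le measurable_const measurable_norm).inter
    (measurableSet_le measurable_norm measurable_const)
  have hI₀J : I₀ ⊆ J := Ioo_subset_Ioo hbb.le le_rfl
  have hI₁J : I₁ ⊆ J := Ioo_subset_Ioo le_rfl hbτ.le
  -- the flux density and its integrability on `J̄ × B̄_{2L}`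
  set F : ℝ → EuclideanSpace ℝ (Fin 3) → ℝ := fun τ y => ‖u τ y‖ ^ 3 + 2 * (|p τ y| * ‖u τ y‖) with hF
  have hF0 : ∀ τ y, 0 ≤ F τ y := fun τ y => by positivity
  set K' : Set (ℝ × EuclideanSpace ℝ (Fin 3)) :=
    Icc (b * (b * τ₀)) τ₀ ×ˢ closedBall (0 : EuclideanSpace ℝ (Fin 3)) (2 * L) with hK'
  have hK'c : IsCompact K' := isCompact_Icc.prod (isCompact_closedBall _ _)
  have hK'S : K' ⊆ ((slab (EuclideanSpace ℝ (Fin 3)) (Iio 0) isOpen_Iio :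
      Opens (ℝ × EuclideanSpace ℝ (Fin 3))) : Set (ℝ × EuclideanSpace ℝ (Fin 3))) := by
    rintro ⟨t, x⟩ ⟨ht, -⟩
    rw [SetLike.mem_coe, mem_slab]
    exact lt_of_le_of_lt ht.2 hτ₀
  have hFK' : IntegrableOn (fun z : ℝ × EuclideanSpace ℝ (Fin 3) => F z.1 z.2) K' volume := by
    exact (hu3.integrableOn_compact_subset hK'S hK'c).add
      ((integrableOn_pressure_velocity_of_suitable hsw hK'c hK'S).const_mul 2)
  have hFJ : IntegrableOn (fun z : ℝ × EuclideanSpace ℝ (Fin 3) => F z.1 z.2) (J ×ˢ SL) volume :=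
    hFK'.mono_set (prod_mono Ioo_subset_Icc_self fun y hy => by
      rw [mem_closedBall, dist_zero_right]; exact hy.2)
  -- the flux bound `Φ`
  set Φ : ℝ := Kσ / (2 * L) * ∫ z in J ×ˢ SL, F z.1 z.2 with hΦ
  -- (1) the two-time local energy inequality against `σL`
  have hLEI := ae_energy_le_add_flux le_rfl hsw hσL_smooth hσL_cpt hσL_nonneg
  -- (2) the flux over `[τ₁, τ₂) ⊆ J` is at most `Φ`
  have hflux : ∀ τ₁ τ₂, τ₁ ∈ I₁ → τ₂ ∈ I₀ →
      ∫ z in Ico τ₁ τ₂ ×ˢ (univ : Set (EuclideanSpace ℝ (Fin 3))),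
        (‖u z.1 z.2‖ ^ 2 * (0 * Δ σL z.2) +
          (‖u z.1 z.2‖ ^ 2 + 2 * p z.1 z.2) * ⟪u z.1 z.2, gradient σL z.2⟫) ≤ Φ := by
    intro τ₁ τ₂ h₁ h₂
    set g : ℝ × EuclideanSpace ℝ (Fin 3) → ℝ := fun z =>
      Kσ / (2 * L) * ((univ : Set ℝ) ×ˢ SL).indicator (fun z => F z.1 z.2) z with hg
    have hg0 : ∀ z, 0 ≤ g z := fun z => mul_nonneg (by positivity)
      (indicator_nonneg (fun w _ => hF0 w.1 w.2) _)
    have hGg : ∀ z : ℝ × EuclideanSpace ℝ (Fin 3),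
        ‖(‖u z.1 z.2‖ ^ 2 * (0 * Δ σL z.2) +
          (‖u z.1 z.2‖ ^ 2 + 2 * p z.1 z.2) * ⟪u z.1 z.2, gradient σL z.2⟫)‖ ≤ g z := by
      intro z
      rw [zero_mul, mul_zero, zero_add, Real.norm_eq_abs, abs_mul]
      by_cases hgz : gradient σL z.2 = 0
      · rw [hgz, inner_zero_right, abs_zero, mul_zero]; exact hg0 z
      · have hz : z ∈ (univ : Set ℝ) ×ˢ SL := ⟨mem_univ _, hgradL_supp _ hgz⟩
        show _ ≤ Kσ / (2 * L) * ((univ : Set ℝ) ×ˢ SL).indicator (fun z => F z.1 z.2) z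
        rw [indicator_of_mem hz]
        calc |‖u z.1 z.2‖ ^ 2 + 2 * p z.1 z.2| * |⟪u z.1 z.2, gradient σL z.2⟫|
            ≤ (‖u z.1 z.2‖ ^ 2 + 2 * |p z.1 z.2|) * (‖u z.1 z.2‖ * ‖gradient σL z.2‖) := by
              refine mul_le_mul ?_ (abs_real_inner_le_norm _ _) (abs_nonneg _) (by positivity)
              calc |‖u z.1 z.2‖ ^ 2 + 2 * p z.1 z.2| ≤ |‖u z.1 z.2‖ ^ 2| + |2 * p z.1 z.2| :=
                    abs_add_le _ _
                _ = ‖u z.1 z.2‖ ^ 2 + 2 * |p z.1 z.2| := by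
                    rw [abs_of_nonneg (by positivity), abs_mul, abs_of_pos (by norm_num : (0:ℝ) < 2)]
          _ ≤ (‖u z.1 z.2‖ ^ 2 + 2 * |p z.1 z.2|) * (‖u z.1 z.2‖ * (Kσ / (2 * L))) := by
              gcongr; exact hgradL_norm _
          _ = Kσ / (2 * L) * F z.1 z.2 := by rw [hF]; ring
    have hsub : Ico τ₁ τ₂ ×ˢ (univ : Set (EuclideanSpace ℝ (Fin 3))) ⊆ J ×ˢ univ :=
      prod_mono (fun t ht => ⟨h₁.1.trans_le ht.1, ht.2.trans h₂.2⟩) subset_rfl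
    have hset : (univ : Set ℝ) ×ˢ SL ∩ J ×ˢ (univ : Set (EuclideanSpace ℝ (Fin 3))) = J ×ˢ SL := by
      rw [prod_inter_prod, univ_inter, inter_univ]
    have hgJ : IntegrableOn g (J ×ˢ (univ : Set (EuclideanSpace ℝ (Fin 3)))) volume := by
      have h1 : IntegrableOn (((univ : Set ℝ) ×ˢ SL).indicator
          fun z : ℝ × EuclideanSpace ℝ (Fin 3) => F z.1 z.2)
          (J ×ˢ (univ : Set (EuclideanSpace ℝ (Fin 3)))) volume := by
        rw [IntegrableOn, integrable_indicator_iff (MeasurableSet.univ.prod hSLm), IntegrableOn,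
          Measure.restrict_restrict (MeasurableSet.univ.prod hSLm), hset]
        exact hFJ
      exact h1.const_mul _
    have hset' : J ×ˢ (univ : Set (EuclideanSpace ℝ (Fin 3))) ∩ (univ : Set ℝ) ×ˢ SL = J ×ˢ SL := by
      rw [prod_inter_prod, inter_univ, univ_inter]
    have h1 := norm_integral_le_of_norm_le (hgJ.mono_set hsub) (Eventually.of_forall hGg)
    rw [Real.norm_eq_abs] at h1
    refine (le_abs_self _).trans (h1.trans ?_)
    calc ∫ z in Ico τ₁ τ₂ ×ˢ (univ : Set (EuclideanSpace ℝ (Fin 3))), g z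
        ≤ ∫ z in J ×ˢ (univ : Set (EuclideanSpace ℝ (Fin 3))), g z :=
          setIntegral_mono_set hgJ (Eventually.of_forall hg0) hsub.eventuallyLE
      _ = Φ := by
          simp only [hg, hΦ]
          rw [integral_const_mul, setIntegral_indicator (MeasurableSet.univ.prod hSLm), hset']
  -- (3) DSS: the energy of the slice `b τ` against `σL` is the energy of the slice `τ` against `σLl`
  set EL : ℝ → ℝ := fun τ => ∫ y, ‖u τ y‖ ^ 2 * σL y with hEL
  set ELl : ℝ → ℝ := fun τ => ∫ y, ‖u τ y‖ ^ 2 * σLl y with hELl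
  have hEL_dss : ∀ τ, τ < 0 → EL (b * τ) = ELl τ := by
    intro τ hτ
    have h := integral_norm_sq_mul_of_dss_slice (V := u τ) (W := u (b * τ)) hl0 ha2
      (fun y => hu τ hτ y) σL
    show (∫ y, ‖u (b * τ) y‖ ^ 2 * σL y) = ∫ y, ‖u τ y‖ ^ 2 * σLl y
    rw [h]
    congr 1; funext z; rw [hσLl_eq]
  -- (4) the inequality for a.e. pair of times of the period `I₀`
  have hgood : ∀ᵐ τ₁' : ℝ, τ₁' ∈ I₀ → ∀ᵐ τ₂ : ℝ, τ₂ ∈ I₀ → EL τ₂ ≤ ELl τ₁' + Φ := by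
    have h1 := ae_comp_mul_left hLEI hb0.ne'
    filter_upwards [h1] with τ₁' hτ₁' hmem
    have hτ₁'0 : τ₁' < 0 := hmem.2.trans hτ₀
    have hbτ₁' : b * τ₁' < 0 := mul_neg_of_pos_of_neg hb0 hτ₁'0
    have h2 := hτ₁' hbτ₁'
    filter_upwards [h2] with τ₂ hτ₂ hτ₂mem
    have hlt : b * τ₁' < b * τ₀ := mul_lt_mul_of_pos_left hmem.2 hb0
    have hτ₂' : τ₂ ∈ Ioo (b * τ₁') 0 := ⟨hlt.trans hτ₂mem.1, hτ₂mem.2.trans hτ₀⟩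
    have h3 := hτ₂ hτ₂'
    have h4 := hflux (b * τ₁') τ₂ ⟨mul_lt_mul_of_pos_left hmem.1 hb0, hlt⟩ hτ₂mem
    have h5 : (∫ y, ‖u (b * τ₁') y‖ ^ 2 * σL y) = ELl τ₁' := hEL_dss τ₁' hτ₁'0
    show (∫ y, ‖u τ₂ y‖ ^ 2 * σL y) ≤ ELl τ₁' + Φ
    linarith
  -- (5) slice energies are bounded on `J` (energy class of the member)
  obtain ⟨C, hC⟩ := exists_ae_slice_energy_facts hsw (α := b * (b * τ₀)) hτ₀ (2 * L)
  have hball : ∀ᵐ t : ℝ, t ∈ J → AEStronglyMeasurable (u t) volume ∧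
      IntegrableOn (fun y => ‖u t y‖ ^ 2) (closedBall (0 : EuclideanSpace ℝ (Fin 3)) (2 * L)) volume := by
    filter_upwards [hC] with t ht htJ
    exact ⟨(ht htJ).1, (ht htJ).2.1⟩
  have hEw : ∀ w : EuclideanSpace ℝ (Fin 3) → ℝ, Continuous w → (∀ y, 0 ≤ w y) → (∀ y, w y ≤ 1) →
      (∀ y, 2 * L ≤ ‖y‖ → w y = 0) →
      ∀ᵐ t : ℝ, t ∈ J → Integrable (fun y => ‖u t y‖ ^ 2 * w y) volume ∧
        0 ≤ ∫ y, ‖u t y‖ ^ 2 * w y ∧ ∫ y, ‖u t y‖ ^ 2 * w y ≤ C := by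
    intro w hwc hw0 hw1 hwz
    filter_upwards [hC] with t ht htJ
    exact (ht htJ).2.2.2 w hwc hw0 hw1 hwz
  have hELw := hEw σL hσL_cont hσL_nonneg hσL_le hσL_zero
  have hELlw := hEw σLl hσLl_cont hσLl_nonneg hσLl_le (fun y hy => hσLl_zero y (by linarith))
  -- the shell energy of a slice is below `EL − ELl`
  have heA_le : ∀ᵐ t : ℝ, t ∈ J → 0 ≤ ∫ y in AL, ‖u t y‖ ^ 2 ∧
      ∫ y in AL, ‖u t y‖ ^ 2 ≤ EL t - ELl t := by
    filter_upwards [hball, hELw, hELlw] with t hb' h1 h2 htJ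
    obtain ⟨-, hI⟩ := hb' htJ
    obtain ⟨hi1, -, -⟩ := h1 htJ
    obtain ⟨hi2, -, -⟩ := h2 htJ
    refine ⟨setIntegral_nonneg hALm fun y _ => by positivity, ?_⟩
    have hAsub : AL ⊆ closedBall (0 : EuclideanSpace ℝ (Fin 3)) (2 * L) := fun y hy => by
      rw [mem_closedBall, dist_zero_right]; linarith [hy.2]
    have hIA : Integrable (AL.indicator fun y => ‖u t y‖ ^ 2) volume :=
      (hI.mono_set hAsub).integrable_indicator hALm
    show (∫ y in AL, ‖u t y‖ ^ 2) ≤ (∫ y, ‖u t y‖ ^ 2 * σL y) - ∫ y, ‖u t y‖ ^ 2 * σLl y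
    rw [← integral_sub hi1 hi2, ← integral_indicator hALm]
    refine integral_mono hIA (hi1.sub hi2) fun y => ?_
    by_cases hy : y ∈ AL
    · rw [indicator_of_mem hy]
      show ‖u t y‖ ^ 2 ≤ ‖u t y‖ ^ 2 * σL y - ‖u t y‖ ^ 2 * σLl y
      rw [hσL_one y hy.2, hσLl_zero y hy.1]; linarith
    · rw [indicator_of_notMem hy]
      show (0 : ℝ) ≤ ‖u t y‖ ^ 2 * σL y - ‖u t y‖ ^ 2 * σLl y
      rw [← mul_sub]
      exact mul_nonneg (by positivity) (hσdiff_nonneg y)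
  -- (6) the good starting slices of the period and the infimum of their `σLl`-energies
  set G : Set ℝ := {t | t ∈ I₀ ∧ (∀ᵐ τ₂ : ℝ, τ₂ ∈ I₀ → EL τ₂ ≤ ELl t + Φ) ∧ 0 ≤ ELl t} with hG
  have hGae : ∀ᵐ t ∂(volume.restrict I₀), t ∈ G := by
    rw [ae_restrict_iff' measurableSet_Ioo]
    filter_upwards [hgood, hELlw] with t h1 h2 htI
    exact ⟨htI, h1 htI, (h2 (hI₀J htI)).2.1⟩
  have hI₀ne : (ae ((volume : Measure ℝ).restrict I₀)).NeBot := by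
    rw [ae_neBot, Ne, Measure.restrict_eq_zero, hI₀, Real.volume_Ioo, ENNReal.ofReal_eq_zero, not_le]
    linarith
  have hGne : (ELl '' G).Nonempty := by
    obtain ⟨t, ht⟩ := hGae.exists
    exact ⟨ELl t, mem_image_of_mem _ ht⟩
  have hGbdd : BddBelow (ELl '' G) := ⟨0, by rintro _ ⟨t, ht, rfl⟩; exact ht.2.2⟩
  set m₀ : ℝ := sInf (ELl '' G) with hm₀
  -- (7) every slice of the period has `σL`-energy at most `m₀ + Φ`
  have hupper : ∀ᵐ τ₂ : ℝ, τ₂ ∈ I₀ → EL τ₂ ≤ m₀ + Φ := by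
    have hn : ∀ n : ℕ, ∀ᵐ τ₂ : ℝ, τ₂ ∈ I₀ → EL τ₂ ≤ m₀ + 1 / ((n : ℝ) + 1) + Φ := by
      intro n
      have hlt : m₀ < m₀ + 1 / ((n : ℝ) + 1) := lt_add_of_pos_right _ Nat.one_div_pos_of_nat
      obtain ⟨_, ⟨t, htG, rfl⟩, hlt'⟩ := exists_lt_of_csInf_lt hGne hlt
      filter_upwards [htG.2.1] with τ₂ h hτ₂
      exact (h hτ₂).trans (by linarith)
    filter_upwards [ae_all_iff.2 hn] with τ₂ h hτ₂
    refine le_of_forall_pos_le_add fun ε hε => ?_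
    obtain ⟨n, hn'⟩ := exists_nat_one_div_lt hε
    linarith [h n hτ₂]
  -- (8) the shell energy of a.e. slice of the period is below `Φ`
  have hshell : ∀ᵐ τ₂ : ℝ, τ₂ ∈ I₀ → (∫ y in AL, ‖u τ₂ y‖ ^ 2) ≤ Φ := by
    have hGae' : ∀ᵐ t : ℝ, t ∈ I₀ → t ∈ G := (ae_restrict_iff' measurableSet_Ioo).1 hGae
    filter_upwards [hupper, hGae', heA_le] with τ₂ h1 h2 h3 hτ₂
    have hlow : m₀ ≤ ELl τ₂ := csInf_le hGbdd (mem_image_of_mem _ (h2 hτ₂))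
    linarith [(h3 (hI₀J hτ₂)).2, h1 hτ₂]
  -- (9) Fubini and the DSS substitution in the flux bound
  set QL : ℝ → ℝ := fun τ => ∫ y in SL, F τ y with hQL
  set QLl : ℝ → ℝ := fun τ => ∫ y in SLl, F τ y with hQLl
  have hFubini : (∫ z in J ×ˢ SL, F z.1 z.2) = ∫ τ in J, QL τ := by
    have hFJ' : IntegrableOn (fun z : ℝ × EuclideanSpace ℝ (Fin 3) => F z.1 z.2) (J ×ˢ SL)
        ((volume : Measure ℝ).prod (volume : Measure (EuclideanSpace ℝ (Fin 3)))) := by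
      rw [← Measure.volume_eq_prod]; exact hFJ
    rw [Measure.volume_eq_prod, setIntegral_prod _ hFJ']
  have hQLint : IntegrableOn QL J volume := by
    have h : Integrable (fun z : ℝ × EuclideanSpace ℝ (Fin 3) => F z.1 z.2)
        ((volume.restrict J).prod (volume.restrict SL)) := by
      rw [Measure.prod_restrict, ← Measure.volume_eq_prod]; exact hFJ
    exact h.integral_prod_left
  have hsplit : (∫ τ in J, QL τ) = (∫ τ in I₁, QL τ) + ∫ τ in I₀, QL τ := by
    have hJ' : J = I₁ ∪ Ico (b * τ₀) τ₀ := (Ioo_union_Ico_eq_Ioo hbb hbτ.le).symm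
    have hdisj : Disjoint I₁ (Ico (b * τ₀) τ₀) :=
      disjoint_left.2 fun x hx hx' => (not_le.2 hx.2) hx'.1
    have hIcoJ : Ico (b * τ₀) τ₀ ⊆ J := fun t ht => ⟨hbb.trans_le ht.1, ht.2⟩
    rw [hJ', setIntegral_union hdisj measurableSet_Ico (hQLint.mono_set hI₁J) (hQLint.mono_set hIcoJ)]
    congr 1
    exact setIntegral_congr_set Ioo_ae_eq_Ico.symm
  have hI₁eq : (∫ τ in I₁, QL τ) = l * ∫ τ in I₀, QLl τ := by
    have hind1 : ∀ (G : EuclideanSpace ℝ (Fin 3) → ℝ) (S : Set (EuclideanSpace ℝ (Fin 3))),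
        MeasurableSet S → (∫ y, G y * S.indicator (fun _ => (1 : ℝ)) y) = ∫ y in S, G y := by
      intro G S hS
      rw [← integral_indicator hS]
      congr 1; funext y
      by_cases hy : y ∈ S
      · rw [indicator_of_mem hy, indicator_of_mem hy, mul_one]
      · rw [indicator_of_notMem hy, indicator_of_notMem hy, mul_zero]
    have hind2 : ∀ z : EuclideanSpace ℝ (Fin 3),
        SL.indicator (fun _ => (1 : ℝ)) (l • z) = SLl.indicator (fun _ => (1 : ℝ)) z := by
      intro z
      have hn : ‖l • z‖ = l * ‖z‖ := by rw [norm_smul, Real.norm_eq_abs, abs_of_pos hl0]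
      by_cases hz : z ∈ SLl
      · have hz' : l • z ∈ SL :=
          ⟨by rw [hn]; exact (div_le_iff₀' hl0).1 hz.1, by rw [hn]; exact (le_div_iff₀' hl0).1 hz.2⟩
        rw [indicator_of_mem hz, indicator_of_mem hz']
      · have hz' : l • z ∉ SL := fun h => hz
          ⟨(div_le_iff₀' hl0).2 (hn ▸ h.1), (le_div_iff₀' hl0).2 (hn ▸ h.2)⟩
        rw [indicator_of_notMem hz, indicator_of_notMem hz']
    have hpt : ∀ τ ∈ I₀, QL (b * τ) = l ^ (-(3 / 2 : ℝ)) * QLl τ := by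
      intro τ hτ
      have hτ0 : τ < 0 := hτ.2.trans hτ₀
      have key := integral_flux_mul_of_dss_slice (V := u τ) (W := u (b * τ)) (P := p τ)
        (Q := p (b * τ)) hl0 ha (fun y => hu τ hτ0 y) (fun y => hp τ hτ0 y)
        (SL.indicator fun _ => (1 : ℝ))
      show (∫ y in SL, F (b * τ) y) = l ^ (-(3 / 2 : ℝ)) * ∫ y in SLl, F τ y
      rw [← hind1 _ SL hSLm, ← hind1 _ SLl hSLlm]
      simp only [hF]
      rw [key]
      congr 2; funext z; rw [hind2]
    show (∫ τ in Ioo (b * (b * τ₀)) (b * τ₀), QL τ) = l * ∫ τ in I₀, QLl τ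
    rw [setIntegral_Ioo_comp_mul_left hb0, setIntegral_congr_fun measurableSet_Ioo hpt,
      integral_const_mul, ← mul_assoc, hbl]
  -- (10) assemble
  have hΦeq : Φ = Kσ / 2 / L * ((∫ τ in I₀, QL τ) + l * ∫ τ in I₀, QLl τ) := by
    rw [hΦ, hFubini, hsplit, hI₁eq]
    field_simp
    ring
  filter_upwards [hshell] with τ₂ h hτ₂
  exact (h hτ₂).trans_eq hΦeq

end SliceShell

end EndpointSobolev

end Summit.NavierStokesRegularity.NavierStokesRegularity.Theorems.PowerGaugeEulerLiouville
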